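import Summits.ResolutionOfSingularities.ResolutionOfSingularities.Theorems.RadicialJungCleanModelsLens5KbarCossartGlobalToLocal
import Summits.ResolutionOfSingularities.ResolutionOfSingularities.Theorems.RadicialJungCleanModelsLens5KbarReadOff2
import Summits.ResolutionOfSingularities.ResolutionOfSingularities.Theorems.RadicialJungCleanModelsPBasisStalk
import Summits.ResolutionOfSingularities.ResolutionOfSingularities.Theorems.RadicialJungCleanModelsClosedPoints
import Summits.ResolutionOfSingularities.ResolutionOfSingularities.Theorems.RadicialJungCleanModelsStubGenerator
import Summits.ResolutionOfSingularities.ResolutionOfSingularities.Theorems.RadicialJungCleanModelsReduction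
import Summits.ResolutionOfSingularities.ResolutionOfSingularities.Theorems.RadicialJungCleanModelsStubStacks0BICLocus
import Summits.ResolutionOfSingularities.ResolutionOfSingularities.Theorems.RadicialJungCleanModelsT2CleanModelsDimLETwoOverField
import Literature.AlgebraicGeometry.Resolution.ResolvingSystems
import Literature.AlgebraicGeometry.Resolution.CossartFunctionNormalForm3
import HarnessLib

/-!
# Route `RadicialJung`, crux `CleanModels` (stmt-15917): the GLOBAL read-off of Cossart 1987 —
# clean models of regular threefolds with a global radicand over an algebraically closed field,
# from the printed theorem `Cossart1987Thm` (F-112) ALONE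

Explicit-unit seat `decomp-res-hand-1` g22 (share: the printed stubs 1–4 of the registered skeleton
`Cruxes/CleanModels/Lines/Sketch.lean` rev 35; stub 3 = `stub_cossart1987Thm : Cossart1987Thm`).  OURS, def-free,
counted 0.  Nothing here proves resolution of singularities in characteristic `p`; `Cossart1987Thm` is a PRINTED theorem
bound as a hypothesis (Cossart 1987, typed from Posva 2024 App. A), nothing is proved by binding it.

Up to now the tree consumed F-112 only ALONG A VALUATION (`Lens5.KbarCossart.cleanLU3_algClosed_of_cossart1987Thm`:
the `k = k̄` slice of the local-uniformization node `cleanLU3_of_stubs`), after which the line still has to PATCH local clean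
models (stubs 4a–4e, research stub 6 `stub_cleanProp44` = X44c).  But Cossart's theorem is GLOBAL: for a quasi-projective
regular threefold `X` over `k̄` and a global function `f ∉ K(X)^p` it delivers a proper birational REGULAR `X' → X` with
`ν = 0` for `f` at EVERY point of `X'`.  Reading `ν = 0` off at the CLOSED points of `X'` (Kimura–Niitsuma `p`-basis of the
stalk ✓ `exists_isPBasisOver_stalk` + the ring-level read-off ✓ `ReadOff.readOff_core`), generising to all points
(✓ `looseCleanAll_of_closedPoints`) and normalising the loose forms (✓ `cleanModels_of_looseCleanAll`) gives the conclusion of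
`CleanModels` for `(W, L)` DIRECTLY — no local uniformization, no patching — whenever the `K(W)^p`-line of `L` has a GLOBAL
representative on a quasi-projective `W`; in particular for every AFFINE regular threefold over `k̄`.

* `looseCleanRep_stalk_of_nuZeroAt` — LEMMA G at a closed point of a regular scheme locally of finite type over ANY field of
  characteristic `p`: `ν = 0` for `f ∈ 𝒪_{X,x}`, `f ∉ K(X)^p`, gives `c₀, c₁ ∈ K(X)`, `c₁ ≠ 0`, with `c₀^p + c₁^p f` loosely clean at `x`.
* `not_pthPower_of_radicand` — a radicand of an element of `L ∖ K` is not a `p`-th power in `K`.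
* `cleanModelsAt_of_cossart1987Thm_of_globalRadicand` — **the conclusion of `CleanModels` for `(W, L)`**, `W` a regular integral
  quasi-projective threefold over `k = k̄`, `L ∋ y₁ ∉ K(W)` with `y₁^p` the germ of a GLOBAL section of `𝒪_W`, from `Cossart1987Thm`.
* `cleanModelsAt_affine_dimThree_algClosed_of_cossart1987Thm` — **the conclusion of `CleanModels` for every AFFINE regular
  integral threefold `W` over an algebraically closed field and every purely inseparable `L/K(W)` of degree `p`**, from
  `Cossart1987Thm` alone (clear the denominator of a radicand: `f = a b^{p-1}`).

So on the slice {`k` algebraically closed, `dim W = 3`, `W` affine} the crux rests on ONE printed theorem and on NEITHER research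
stub (5: class (B) non-discrete defect valuations; 6: X44c clean Prop. 4.4) of the registered line; the slice is not the crux
(`W` there is any separated `W` of finite type, `k` any field of characteristic `p`).
-/

noncomputable section

set_option linter.dupNamespace false -- mandated namespace of this single-conjunct summit

open IsLocalRing
open Literature.AlgebraicGeometry.Resolution
open Summit.ResolutionOfSingularities.ResolutionOfSingularities.Theorems.RadicialJung.CleanModels
open Literature.RingTheory.PBasis
open CategoryTheory AlgebraicGeometry TopologicalSpace
open Literature.AlgebraicGeometry.CossartPiltant200819.CP2008
open Literature.AlgebraicGeometry.Motives

namespace Summit.ResolutionOfSingularities.ResolutionOfSingularities.Theorems.RadicialJung.CleanModels.KbarGlobal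

/-- **LEMMA G at a closed point** (every ground field `k` of characteristic `p`): at a CLOSED point `x` of a regular integral
scheme `X` locally of finite type over `k`, Cossart's `ν = 0` (`NuZeroAt`) for `f ∈ 𝒪_{X,x}` yields `c₀, c₁ ∈ K(X)`, `c₁ ≠ 0`, with
`c₀^p + c₁^p f` in one of the three loosely clean forms at `𝒪_{X,x}` (unit times a monomial in a regular system of parameters with
exponents prime to `p`; a unit residually not a `p`-th power; `c^p +` a regular parameter).  Kernel: a `p`-basis of the stalk containing
the regular system of parameters of `ν = 0` (✓ `exists_isPBasisOver_stalk`, Kimura–Niitsuma) and the ring-level read-off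
✓ `ReadOff.readOff_core`. [folklore] -/
theorem looseCleanRep_stalk_of_nuZeroAt (p : ℕ) [Fact p.Prime] (k : Type) [Field k] [CharP k p]
    {X : Scheme.{0}} [IsIntegral X] (q : X ⟶ Spec (.of k)) [LocallyOfFiniteType q] (hreg : Scheme.IsRegular X)
    {x : X} (hx : IsClosed ({x} : Set X)) (f : X.presheaf.stalk x)
    (hf : ∀ c : X.functionField, c ^ p ≠ algebraMap (X.presheaf.stalk x) X.functionField f) (hN : NuZeroAt f) :
    ∃ c₀ c₁ : X.functionField, c₁ ≠ 0 ∧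
    ((∃ (d' m : ℕ) (hmd : m ≤ d') (t' : Fin d' → X.presheaf.stalk x) (a' : Fin m → ℕ) (w : X.presheaf.stalk x), IsUnit w ∧
        Ideal.span (Set.range t') = maximalIdeal (X.presheaf.stalk x) ∧
        ringKrullDim (X.presheaf.stalk x) = (d' : WithBot ℕ∞) ∧ 0 < m ∧ (∀ i, ¬ p ∣ a' i) ∧
        c₀ ^ p + c₁ ^ p * algebraMap (X.presheaf.stalk x) X.functionField f =
          algebraMap (X.presheaf.stalk x) X.functionField (w * ∏ i : Fin m, t' (Fin.castLE hmd i) ^ (a' i))) ∨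
     (∃ w : X.presheaf.stalk x, IsUnit w ∧
        c₀ ^ p + c₁ ^ p * algebraMap (X.presheaf.stalk x) X.functionField f =
          algebraMap (X.presheaf.stalk x) X.functionField w ∧
        ∀ c : X.presheaf.stalk x, w - c ^ p ∉ maximalIdeal (X.presheaf.stalk x)) ∨
     (∃ s c : X.presheaf.stalk x,
        c₀ ^ p + c₁ ^ p * algebraMap (X.presheaf.stalk x) X.functionField f =
          algebraMap (X.presheaf.stalk x) X.functionField s ∧
        s - c ^ p ∈ maximalIdeal (X.presheaf.stalk x) ∧ s - c ^ p ∉ maximalIdeal (X.presheaf.stalk x) ^ 2)) := by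
  classical
  haveI : CharP (X.presheaf.stalk x) p := charP_stalk X q x
  haveI : IsRegularLocalRing (X.presheaf.stalk x) := hreg x
  obtain ⟨d, e, hed, t, b, ht, hd, hJ⟩ := hN
  obtain ⟨Γ, htΓ, hΓ⟩ := exists_isPBasisOver_stalk p k q hreg hx t ht hd
  exact Lens5.KbarCossart.ReadOff.readOff_core hΓ hed t (fun i => t (Fin.castLE hed i)) (fun _ => rfl) b ht hd htΓ f hf hJ

/-- **A radicand of an element outside the base field is not a `p`-th power** (`char = p`): if `y ∉ K` and `g ↦ y^p` under
`K → L`, then `c^p ≠ g` for every `c ∈ K` (Frobenius is injective on the field `L`). [folklore] -/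
theorem not_pthPower_of_radicand {K L : Type*} [Field K] [Field L] [Algebra K L] (p : ℕ) (hp : p.Prime) [CharP K p]
    (y : L) (hy : y ∉ Set.range (algebraMap K L)) (g : K) (hg : algebraMap K L g = y ^ p) :
    ∀ c : K, c ^ p ≠ g := by
  intro c hc
  haveI : CharP L p := charP_of_injective_algebraMap (algebraMap K L).injective p
  haveI : Fact p.Prime := ⟨hp⟩
  apply hy
  refine ⟨c, ?_⟩
  have h1 : (algebraMap K L c - y) ^ p = 0 := by
    rw [sub_pow_char, ← map_pow, hc, hg, sub_self]
  exact sub_eq_zero.mp (pow_eq_zero_iff hp.ne_zero |>.mp h1)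

/-- **An admissible modification of a radical stays outside the base field**: if `y₁ ∉ K` and `c₁ ≠ 0` then `c₀ + c₁ y₁ ∉ K`.
[folklore] -/
theorem add_mul_not_mem_range {K L : Type*} [Field K] [Field L] [Algebra K L]
    (y₁ : L) (hy₁ : y₁ ∉ Set.range (algebraMap K L)) (c₀ c₁ : K) (hc₁ : c₁ ≠ 0) :
    algebraMap K L c₀ + algebraMap K L c₁ * y₁ ∉ Set.range (algebraMap K L) := by
  rintro ⟨z, hz⟩
  apply hy₁
  refine ⟨(z - c₀) / c₁, ?_⟩
  rw [map_div₀, map_sub, hz, add_sub_cancel_left, mul_div_cancel_left₀ _ ((map_ne_zero _).mpr hc₁)]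

/-- **`CleanModels` for a regular quasi-projective threefold over `k̄` with a GLOBAL radicand, from `Cossart1987Thm` alone.**
For `p` prime, `k` algebraically closed of characteristic `p`, `W` a regular integral separated quasi-compact threefold locally of
finite type and quasi-projective over `k`, `L ⊇ K(W)` any field extension containing `y₁ ∉ K(W)` whose `p`-th power is the germ of a
GLOBAL section `fW ∈ Γ(W, 𝒪_W)`: there is a proper birational `π : V → W`, `V` integral and regular, such that at EVERY point `v ∈ V`
some `y ∈ L ∖ K(W)`, `y^p = g ∈ K(W)`, has `π^* g` EXACTLY clean (the pointwise conclusion of the crux `CleanModels`).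
Proof: Cossart 1987 on `(W, fW)` gives `π : X' → W` proper, an isomorphism over a non-empty open (hence birational and dominant,
✓ `isBirational_and_denseRange`), `X'` integral regular with `ν = 0` for `π^* fW` everywhere; at a closed `x' ∈ X'` read off
`c₀^p + c₁^p · π^* fW` loosely clean (`looseCleanRep_stalk_of_nuZeroAt`), pull `c₀, c₁` back along `π^♯ : K(W) ≅ K(X')` and set
`y := c₀ + c₁ y₁`, `g := c₀^p + c₁^p fW`; generise (✓ `looseCleanAll_of_closedPoints`) and normalise (✓ `cleanModels_of_looseCleanAll`).
[folklore] -/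
theorem cleanModelsAt_of_cossart1987Thm_of_globalRadicand (h : Cossart1987Thm)
    (p : ℕ) (hp : p.Prime) (k : Type) [Field k] [CharP k p] [IsAlgClosed k]
    (W : Scheme.{0}) [IsIntegral W] (f : W ⟶ Spec (.of k)) [IsSeparated f] [LocallyOfFiniteType f]
    [QuasiCompact f] (hqp : IsQuasiProjectiveOver f) (hW : Scheme.IsRegular W) (hdim : topologicalKrullDim W = 3)
    (L : Type) [Field L] [Algebra W.functionField L]
    (fW : Γ(W, ⊤)) (y₁ : L) (hy₁ : y₁ ∉ Set.range (algebraMap W.functionField L))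
    (hfy : algebraMap W.functionField L ((W.presheaf.germ ⊤ (genericPoint W) trivial) fW) = y₁ ^ p) :
    ∃ (V : Scheme.{0}) (π : V ⟶ W) (_ : IsIntegral V) (_ : IsDominant π),
      IsProper π ∧ IsBirational π ∧ Scheme.IsRegular V ∧
      (∀ v : V, (∃ (y : L) (g : W.functionField), y ∉ Set.range (algebraMap W.functionField L) ∧
        algebraMap W.functionField L g = y ^ p ∧
        ((∃ (d m : ℕ) (hmd : m ≤ d) (t : Fin d → V.presheaf.stalk v) (a : Fin m → ℕ),
            Ideal.span (Set.range t) = maximalIdeal (V.presheaf.stalk v) ∧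
            ringKrullDim (V.presheaf.stalk v) = (d : WithBot ℕ∞) ∧ 0 < m ∧ (∀ i, ¬ p ∣ a i) ∧
            RatFn.functionFieldMap π g = ∏ i : Fin m,
              (algebraMap (V.presheaf.stalk v) V.functionField (t (Fin.castLE hmd i))) ^ (a i)) ∨
          (∃ u₀ : V.presheaf.stalk v, IsUnit u₀ ∧
            RatFn.functionFieldMap π g = algebraMap (V.presheaf.stalk v) V.functionField u₀ ∧
            ((∀ c : V.presheaf.stalk v, u₀ - c ^ p ∉ maximalIdeal (V.presheaf.stalk v)) ∨
              (∃ c : V.presheaf.stalk v, u₀ - c ^ p ∈ maximalIdeal (V.presheaf.stalk v) ∧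
                u₀ - c ^ p ∉ maximalIdeal (V.presheaf.stalk v) ^ 2)))))) := by
  classical
  haveI : Fact p.Prime := ⟨hp⟩
  haveI : CharP W.functionField p := charP_stalk W f _
  haveI : CompactSpace W := QuasiCompact.compactSpace_of_compactSpace f
  set f₀ : W.functionField := (W.presheaf.germ ⊤ (genericPoint W) trivial) fW with hf₀def
  -- the global radicand is not a `p`-th power in `K(W)`
  have hf₀ : ∀ c : W.functionField, c ^ p ≠ f₀ := not_pthPower_of_radicand p hp y₁ hy₁ f₀ hfy
  -- Cossart 1987 on `(W, fW)`
  obtain ⟨X', π, hπ, hX'int, hX'reg, ⟨U, hUne, hUiso⟩, hν⟩ := h p k W f hqp hW hdim fW hf₀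
  haveI := hπ
  haveI := hX'int
  haveI := hUiso
  obtain ⟨hbir, hdense⟩ := Lens5.KbarCossart.isBirational_and_denseRange π U hUne
  haveI hdom : IsDominant π := ⟨hdense⟩
  -- `π^♯ : K(W) ≅ K(X')`
  have hbij : Function.Bijective (RatFn.functionFieldMap π) := by
    obtain ⟨U', hU', hU'', hiso⟩ := hbir
    haveI := hiso
    exact RatFn.functionFieldMap_bijective_of_isIso_morphismRestrict π U' hU' hU''
  let e : W.functionField ≃+* X'.functionField := RingEquiv.ofBijective _ hbij
  have he : ∀ z, e z = RatFn.functionFieldMap π z := fun _ => rfl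
  -- loose cleanness at the CLOSED points of `X'`
  have hclosed : ∀ x' : X', IsClosed ({x'} : Set X') → ∃ (y : L) (g : W.functionField),
      y ∉ Set.range (algebraMap W.functionField L) ∧ algebraMap W.functionField L g = y ^ p ∧
      ((∃ (d m : ℕ) (hmd : m ≤ d) (t : Fin d → X'.presheaf.stalk x') (a : Fin m → ℕ)
          (u : X'.presheaf.stalk x'), IsUnit u ∧
          Ideal.span (Set.range t) = maximalIdeal (X'.presheaf.stalk x') ∧
          ringKrullDim (X'.presheaf.stalk x') = (d : WithBot ℕ∞) ∧ 0 < m ∧ (∀ i, ¬ p ∣ a i) ∧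
          RatFn.functionFieldMap π g = algebraMap (X'.presheaf.stalk x') X'.functionField
            (u * ∏ i : Fin m, t (Fin.castLE hmd i) ^ (a i))) ∨
        (∃ u : X'.presheaf.stalk x', IsUnit u ∧
          RatFn.functionFieldMap π g = algebraMap (X'.presheaf.stalk x') X'.functionField u ∧
          ∀ c : X'.presheaf.stalk x', u - c ^ p ∉ maximalIdeal (X'.presheaf.stalk x')) ∨
        (∃ s c : X'.presheaf.stalk x',
          RatFn.functionFieldMap π g = algebraMap (X'.presheaf.stalk x') X'.functionField s ∧
          s - c ^ p ∈ maximalIdeal (X'.presheaf.stalk x') ∧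
          s - c ^ p ∉ maximalIdeal (X'.presheaf.stalk x') ^ 2)) := by
    intro x' hx'
    -- the germ of `π^* fW` at `x'` and its image in `K(X')`
    let gx : X'.presheaf.stalk x' := X'.presheaf.germ ⊤ x' trivial (π.appTop fW)
    have hνx : NuZeroAt gx := hν x'
    have hgen : algebraMap (X'.presheaf.stalk x') X'.functionField gx = RatFn.functionFieldMap π f₀ := by
      have h2 : gx = π.stalkMap x' (W.presheaf.germ ⊤ (π.base x') trivial fW) := by
        rw [Scheme.Hom.germ_stalkMap_apply]; rfl
      rw [h2]
      change RatFn.toFunctionField x' (π.stalkMap x' _) = _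
      rw [← RatFn.functionFieldMap_toFunctionField]
      congr 1
      haveI : Nonempty (⊤ : W.Opens) := ⟨⟨genericPoint W, Set.mem_univ _⟩⟩
      exact Scheme.algebraMap_germ_eq_germToFunctionField (X := W) (U := ⊤) (x := π.base x') (Set.mem_univ _) fW
    have hgx : ∀ c : X'.functionField, c ^ p ≠ algebraMap (X'.presheaf.stalk x') X'.functionField gx := by
      intro c hc
      obtain ⟨c', rfl⟩ := hbij.2 c
      rw [hgen, ← map_pow] at hc
      exact hf₀ c' (hbij.1 hc)
    haveI : LocallyOfFiniteType (π ≫ f) := inferInstance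
    obtain ⟨c₀, c₁, hc₁, hforms⟩ :=
      looseCleanRep_stalk_of_nuZeroAt p k (π ≫ f) hX'reg hx' gx hgx hνx
    -- pull `c₀, c₁` back to `K(W)`
    set c₀' : W.functionField := e.symm c₀ with hc₀'def
    set c₁' : W.functionField := e.symm c₁ with hc₁'def
    have hc₁' : c₁' ≠ 0 := by
      intro h0
      apply hc₁
      rw [← e.apply_symm_apply c₁, ← hc₁'def, h0, map_zero]
    set g : W.functionField := c₀' ^ p + c₁' ^ p * f₀ with hgdef
    have heg : RatFn.functionFieldMap π g =
        c₀ ^ p + c₁ ^ p * algebraMap (X'.presheaf.stalk x') X'.functionField gx := by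
      rw [← he, hgdef, map_add, map_mul, map_pow, map_pow, hc₀'def, hc₁'def, e.apply_symm_apply,
        e.apply_symm_apply, he, hgen]
    refine ⟨algebraMap W.functionField L c₀' + algebraMap W.functionField L c₁' * y₁, g,
      add_mul_not_mem_range y₁ hy₁ c₀' c₁' hc₁', ?_, ?_⟩
    · -- `g ↦ (c₀' + c₁' y₁)^p`
      haveI : CharP L p := charP_of_injective_algebraMap (algebraMap W.functionField L).injective p
      rw [hgdef, map_add, map_mul, map_pow, map_pow, hfy, add_pow_char, mul_pow]
    · rcases hforms with ⟨d', m, hmd, t', a', w, hw, ht', hd', hm, ha', heq⟩ | ⟨w, hw, heq, hres⟩ |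
          ⟨s, c', heq, hm1, hm2⟩
      · exact Or.inl ⟨d', m, hmd, t', a', w, hw, ht', hd', hm, ha', by rw [heg, heq]⟩
      · exact Or.inr (Or.inl ⟨w, hw, by rw [heg, heq], hres⟩)
      · exact Or.inr (Or.inr ⟨s, c', by rw [heg, heq], hm1, hm2⟩)
  -- generise to every point and normalise the loose forms
  refine ⟨X', π, hX'int, hdom, hπ, hbir, hX'reg, fun v => ?_⟩
  exact cleanModels_of_looseCleanAll p hp k W f L X' π hbir
    (looseCleanAll_of_closedPoints p hp k W f L X' π hbir hX'reg hclosed) v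

/-- **`CleanModels` FOR AFFINE REGULAR THREEFOLDS OVER AN ALGEBRAICALLY CLOSED FIELD, FROM `Cossart1987Thm` ALONE.**
For `p` prime, `k` algebraically closed of characteristic `p`, `W` an AFFINE regular integral threefold (separated, quasi-compact,
locally of finite type over `k`, `dim W = 3`) and `L/K(W)` purely inseparable of degree `p`, the pointwise conclusion of the crux
`CleanModels` holds for `(W, L)`: a proper birational regular `V → W` on which, at every point, some `y ∈ L ∖ K(W)`, `y^p = g`,
has `π^* g` exactly clean.  Proof: a generator `y₀`, `y₀^p = g₀ = a/b` with `a, b ∈ Γ(W, 𝒪_W)` (`K(W) = Frac Γ(W, 𝒪_W)` for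
affine integral `W`); the global radicand `fW := a b^{p-1}` has germ `g₀ b^p = (b y₀)^p`; affine ⟹ quasi-projective
(✓ `CP2008.isQuasiProjectiveOver_of_isAffine`); apply `cleanModelsAt_of_cossart1987Thm_of_globalRadicand`.
On this slice (`k = k̄`, `dim W = 3`, `W` affine) the crux therefore rests on the single printed theorem Cossart 1987 and on
neither research stub of the registered line (no local uniformization, no patching). [folklore] -/
theorem cleanModelsAt_affine_dimThree_algClosed_of_cossart1987Thm (h : Cossart1987Thm)
    (p : ℕ) (hp : p.Prime) (k : Type) [Field k] [CharP k p] [IsAlgClosed k]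
    (W : Scheme.{0}) [IsIntegral W] [IsAffine W] (f : W ⟶ Spec (.of k)) [IsSeparated f] [LocallyOfFiniteType f]
    [QuasiCompact f] (hW : Scheme.IsRegular W) (hdim : topologicalKrullDim W = 3)
    (L : Type) [Field L] [Algebra W.functionField L]
    [IsPurelyInseparable W.functionField L] (hdeg : Module.finrank W.functionField L = p) :
    ∃ (V : Scheme.{0}) (π : V ⟶ W) (_ : IsIntegral V) (_ : IsDominant π),
      IsProper π ∧ IsBirational π ∧ Scheme.IsRegular V ∧
      (∀ v : V, (∃ (y : L) (g : W.functionField), y ∉ Set.range (algebraMap W.functionField L) ∧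
        algebraMap W.functionField L g = y ^ p ∧
        ((∃ (d m : ℕ) (hmd : m ≤ d) (t : Fin d → V.presheaf.stalk v) (a : Fin m → ℕ),
            Ideal.span (Set.range t) = maximalIdeal (V.presheaf.stalk v) ∧
            ringKrullDim (V.presheaf.stalk v) = (d : WithBot ℕ∞) ∧ 0 < m ∧ (∀ i, ¬ p ∣ a i) ∧
            RatFn.functionFieldMap π g = ∏ i : Fin m,
              (algebraMap (V.presheaf.stalk v) V.functionField (t (Fin.castLE hmd i))) ^ (a i)) ∨
          (∃ u₀ : V.presheaf.stalk v, IsUnit u₀ ∧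
            RatFn.functionFieldMap π g = algebraMap (V.presheaf.stalk v) V.functionField u₀ ∧
            ((∀ c : V.presheaf.stalk v, u₀ - c ^ p ∉ maximalIdeal (V.presheaf.stalk v)) ∨
              (∃ c : V.presheaf.stalk v, u₀ - c ^ p ∈ maximalIdeal (V.presheaf.stalk v) ∧
                u₀ - c ^ p ∉ maximalIdeal (V.presheaf.stalk v) ^ 2)))))) := by
  classical
  haveI : Fact p.Prime := ⟨hp⟩
  haveI : CharP W.functionField p := charP_stalk W f _
  -- a generator `y₀` of `L/K(W)` with radicand `g₀ ∉ K(W)^p`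
  obtain ⟨-, y₀, g₀, hy₀, hg₀, -⟩ := stub_generator (K := W.functionField) (L := L) p hp hdeg
  -- `K(W) = Frac Γ(W, 𝒪_W)` for the affine integral `W`
  haveI : Nonempty (⊤ : W.Opens) := ⟨⟨genericPoint W, Set.mem_univ _⟩⟩
  haveI : IsFractionRing Γ(W, ⊤) W.functionField :=
    functionField_isFractionRing_of_isAffineOpen W ⊤ (isAffineOpen_top W)
  obtain ⟨a, b, hb, hab⟩ := IsFractionRing.div_surjective (A := Γ(W, ⊤)) g₀
  have hb0 : algebraMap Γ(W, ⊤) W.functionField b ≠ 0 :=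
    IsFractionRing.to_map_ne_zero_of_mem_nonZeroDivisors hb
  -- the global radicand `fW = a b^{p-1}`, germ `g₀ b^p`
  set fW : Γ(W, ⊤) := a * b ^ (p - 1) with hfWdef
  have hgerm : (W.presheaf.germ ⊤ (genericPoint W) trivial) fW =
      g₀ * algebraMap Γ(W, ⊤) W.functionField b ^ p := by
    change algebraMap Γ(W, ⊤) W.functionField fW = _
    rw [hfWdef, map_mul, map_pow, ← hab]
    have hp1 : p = (p - 1) + 1 := (Nat.sub_add_cancel hp.one_lt.le).symm
    conv_rhs => rw [hp1]
    rw [pow_succ, div_mul_eq_mul_div, ← mul_assoc, mul_div_cancel_right₀ _ hb0]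
  -- the element `b y₀ ∈ L ∖ K(W)` with `(b y₀)^p = germ fW`
  have hy₁ : algebraMap W.functionField L (algebraMap Γ(W, ⊤) W.functionField b) * y₀ ∉
      Set.range (algebraMap W.functionField L) := by
    have := add_mul_not_mem_range y₀ hy₀ 0 (algebraMap Γ(W, ⊤) W.functionField b) hb0
    rwa [map_zero, zero_add] at this
  have hfy : algebraMap W.functionField L ((W.presheaf.germ ⊤ (genericPoint W) trivial) fW) =
      (algebraMap W.functionField L (algebraMap Γ(W, ⊤) W.functionField b) * y₀) ^ p := by
    rw [hgerm, map_mul, map_pow, hg₀, mul_pow, mul_comm]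
  exact cleanModelsAt_of_cossart1987Thm_of_globalRadicand h p hp k W f (isQuasiProjectiveOver_of_isAffine f) hW hdim L
    fW _ hy₁ hfy

/-- **`CleanModels` for affine regular integral `W` of dimension `≤ 3` over an algebraically closed field, from `Cossart1987Thm` alone**
(appended, same seat): dimension `≤ 2` is UNCONDITIONAL in the tree for every `W` and every ground field (F-75c ✓ `stub_stacks0BICLocus` through
✓ `cleanModels_dimLETwo_of_f75c`); dimension `3` is `cleanModelsAt_affine_dimThree_algClosed_of_cossart1987Thm`; the dimension trichotomy is
✓ `le_two_or_eq_three_of_le_three`.  So the printed theorem Cossart 1987 is the ONLY input of the crux on {`k = k̄`, `W` affine, `dim W ≤ 3`}.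
[folklore] -/
theorem cleanModelsAt_affine_dimLEThree_algClosed_of_cossart1987Thm (h : Cossart1987Thm)
    (p : ℕ) (hp : p.Prime) (k : Type) [Field k] [CharP k p] [IsAlgClosed k]
    (W : Scheme.{0}) [IsIntegral W] [IsAffine W] (f : W ⟶ Spec (.of k)) [IsSeparated f] [LocallyOfFiniteType f]
    [QuasiCompact f] (hW : Scheme.IsRegular W) (hdim : topologicalKrullDim W ≤ 3)
    (L : Type) [Field L] [Algebra W.functionField L]
    [IsPurelyInseparable W.functionField L] (hdeg : Module.finrank W.functionField L = p) :
    ∃ (V : Scheme.{0}) (π : V ⟶ W) (_ : IsIntegral V) (_ : IsDominant π),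
      IsProper π ∧ IsBirational π ∧ Scheme.IsRegular V ∧
      (∀ v : V, (∃ (y : L) (g : W.functionField), y ∉ Set.range (algebraMap W.functionField L) ∧
        algebraMap W.functionField L g = y ^ p ∧
        ((∃ (d m : ℕ) (hmd : m ≤ d) (t : Fin d → V.presheaf.stalk v) (a : Fin m → ℕ),
            Ideal.span (Set.range t) = maximalIdeal (V.presheaf.stalk v) ∧
            ringKrullDim (V.presheaf.stalk v) = (d : WithBot ℕ∞) ∧ 0 < m ∧ (∀ i, ¬ p ∣ a i) ∧
            RatFn.functionFieldMap π g = ∏ i : Fin m,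
              (algebraMap (V.presheaf.stalk v) V.functionField (t (Fin.castLE hmd i))) ^ (a i)) ∨
          (∃ u₀ : V.presheaf.stalk v, IsUnit u₀ ∧
            RatFn.functionFieldMap π g = algebraMap (V.presheaf.stalk v) V.functionField u₀ ∧
            ((∀ c : V.presheaf.stalk v, u₀ - c ^ p ∉ maximalIdeal (V.presheaf.stalk v)) ∨
              (∃ c : V.presheaf.stalk v, u₀ - c ^ p ∈ maximalIdeal (V.presheaf.stalk v) ∧
                u₀ - c ^ p ∉ maximalIdeal (V.presheaf.stalk v) ^ 2)))))) := by
  rcases le_two_or_eq_three_of_le_three hdim with h2 | h3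
  · exact cleanModels_dimLETwo_of_f75c stub_stacks0BICLocus p hp k W f hW L hdeg h2
  · exact cleanModelsAt_affine_dimThree_algClosed_of_cossart1987Thm h p hp k W f hW h3 L hdeg

end Summit.ResolutionOfSingularities.ResolutionOfSingularities.Theorems.RadicialJung.CleanModels.KbarGlobal

end
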